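import Mathlib.Combinatorics.SetFamily.Compression.Down
import Mathlib.Tactic
import HarnessLib
import HarnessLib.Audit.Tags
import Summits.CriticalPhenomena.PercolationContinuityZ3.Theorems.PercNearOneGluingNoHeavyLowerTailSahiRainbowTwoColourDeficitLocal
import Summits.CriticalPhenomena.PercolationContinuityZ3.Theorems.PercNearOneGluingNoHeavyLowerTailSahiRainbowTwoColourDeficitMixK
import Summits.CriticalPhenomena.PercolationContinuityZ3.Theorems.PercNearOneGluingNoHeavyLowerTailSahiRainbowTwoColourDeficitS1
import Summits.CriticalPhenomena.PercolationContinuityZ3.Theorems.PercNearOneGluingNoHeavyLowerTailSahiRainbowTwoColourDeficitS2b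

/-!
# The sparse residual is LOCAL, VII: NO THREE DEFICIT POINTS — `SparseTwinPoint` PROVED

Support file (seat `prim-masterthm-p1`, gen 42; `--supports stmt-CriticalPhenomena-4575`).  No `sorry`, standard axioms.
Blueprint `run/shared/lean/prim/prim-masterthm/FROM-prim-masterthm-p1-g42-*.md` (PROOFS §4–§5).

SETTING (`…SahiRainbowTwoColourDeficitDefs`): `Z = K ⊔ K' ⊆ 2^G` complement-closed (colour classes in either order),
`L = monoMeets K K'`; monochromatic bisections `Bisect C Z G y A A'` (`A, A' ∈ C`, `A ∩ A' = {y}`, `A ∪ A' = G`, lower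
members in `Z`); D-points `DAt` (a `K`- and a `K'`-bisection, `{y} ∈ L`, no non-empty twin) and Q-points `Q3At K K'`
(`{y} ∈ K`, `G ∈ K'`, `G ∖ y ∈ Z`, a `K`-bisection, no non-empty twin).

THIS FILE (assembly): `false_of_three_deficit` — no three points of a configuration (with a fourth point of `G`) are deficit
(`0 < #D_y < 6`, `2 · #twins_y < #D_y`): an S₁-point excludes S₂-points (`…MixK`), three S₁-points are impossible
(`…DeficitS1`), three S₂-points are impossible (`…DeficitS2b`: D³ when `∅ ∉ Z`; DDG/DQ/Q³ when `∅ ∈ Z`).  Hence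
**`sparseTwinPoint : SparseTwinPoint α`** (the typed residual of `…TwoColourTwinPoint`, PROVED), and
`twoColourMeets_of_small`, `rainbowStrict_of_small`, `rainbowMeetCojoin_of_small`: the two-colouring statement M3♯, the
strict rainbow lemma and the rainbow lemma `RainbowMeetCojoin` all follow from `SmallTwoColourMeets` ALONE (the cases
`#Z ∈ {{6, 8}}`, verified dimension-free by computation; kernel replay = the remaining target).
HONEST FRAMING: unconditional combinatorial lemmas (the local three-direction analysis of the sparse residual). [this work]
-/

namespace Summit.CriticalPhenomena.PercolationContinuityZ3.Theorems.SahiColouredDaykin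

open Finset
open scoped FinsetFamily

variable {α : Type*} [DecidableEq α]

/-! ### 1. From three deficit points to a contradiction -/

section Assembly

variable {X Y : Finset (Finset α)} {G : Finset α}

/-- All three points are S₂-points and `∅ ∈ Z` with `G ∈ K'`: absurd.  Each point is given as a D-point or a Q-point for the
classes `(K, K')`. [this work] -/
theorem s2_three_false {K K' : Finset (Finset α)} (hKK' : Disjoint K K') (hcc : ∀ z ∈ K ∪ K', G \ z ∈ K ∪ K')
    (hGK' : G ∈ K') {y₁ y₂ y₃ : α} (h12 : y₁ ≠ y₂) (h13 : y₁ ≠ y₃) (h23 : y₂ ≠ y₃)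
    (hG4 : ∃ t ∈ G, t ≠ y₁ ∧ t ≠ y₂ ∧ t ≠ y₃)
    (p₁ : (∃ A A' B B', DAt K K' G y₁ A A' B B') ∨ (∃ C C', Q3At K K' G y₁ C C'))
    (p₂ : (∃ A A' B B', DAt K K' G y₂ A A' B B') ∨ (∃ C C', Q3At K K' G y₂ C C'))
    (p₃ : (∃ A A' B B', DAt K K' G y₃ A A' B B') ∨ (∃ C C', Q3At K K' G y₃ C C')) : False := by
  -- T₁-data at a point: a `K`-bisection, `G ∖ y ∈ Z`, no non-empty twin
  have T1 : ∀ {y : α}, ((∃ A A' B B', DAt K K' G y A A' B B') ∨ (∃ C C', Q3At K K' G y C C')) →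
      {y} ∈ K ∪ K' → ∃ C C', Bisect K (K ∪ K') G y C C' ∧ G.erase y ∈ K ∪ K' ∧ NoTwin (monoMeets K K') y := by
    intro y p hs
    have hGy : G.erase y ∈ K ∪ K' := by
      have := hcc _ hs
      rwa [sdiff_singleton_eq_erase] at this
    rcases p with ⟨A, A', B, B', h⟩ | ⟨C, C', h⟩
    · exact ⟨A, A', h.bisX, hGy, h.noTwin⟩
    · exact ⟨C, C', h.bis, hGy, h.noTwin⟩
  -- a D-point without singleton member (T₀) excludes any second point
  have T0 : ∀ {y y' : α} {A A' B B' : Finset α}, DAt K K' G y A A' B B' → {y} ∉ K ∪ K' → y ≠ y' →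
      ((∃ A A' B B', DAt K K' G y' A A' B B') ∨ (∃ C C', Q3At K K' G y' C C')) → False := by
    intro y y' A A' B B' h hs hyy' p
    rcases p with ⟨A₂, A₂', B₂, B₂', h₂⟩ | ⟨C, C', h₂⟩
    · exact hs (mem_union_right _ (h.singleton_mem_of_pair hGK' h₂ hyy'))
    · exact h.false_of_Q3At hKK' hs h₂ hyy'
  -- singleton members present?
  have single : ∀ {y : α}, ((∃ A A' B B', DAt K K' G y A A' B B') ∨ (∃ C C', Q3At K K' G y C C')) →
      (∀ {y' : α}, y ≠ y' → ((∃ A A' B B', DAt K K' G y' A A' B B') ∨ (∃ C C', Q3At K K' G y' C C')) → False) ∨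
      {y} ∈ K ∪ K' := by
    intro y p
    by_cases hs : {y} ∈ K ∪ K'
    · exact Or.inr hs
    rcases p with ⟨A, A', B, B', h⟩ | ⟨C, C', h⟩
    · exact Or.inl (fun hyy' p' => T0 h hs hyy' p')
    · exact Or.inr (mem_union_left _ h.single_mem)
  rcases single p₁ with h | hs₁
  · exact h h12 p₂
  rcases single p₂ with h | hs₂
  · exact h h12.symm p₁
  rcases single p₃ with h | hs₃
  · exact h h13.symm p₁
  obtain ⟨C₁, C₁', hC₁, hG₁, htw₁⟩ := T1 p₁ hs₁
  obtain ⟨C₂, C₂', hC₂, hG₂, htw₂⟩ := T1 p₂ hs₂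
  obtain ⟨C₃, C₃', hC₃, hG₃, htw₃⟩ := T1 p₃ hs₃
  exact Bisect.false_of_three_qq hKK' hGK' hG₁ hG₂ hG₃ hC₁ hC₂ hC₃ htw₁ htw₂ htw₃ h12 h13 h23 hG4

/-- The local-structure alternatives at a point, abbreviated. [this work] -/
theorem deficit_cases (hXY : Disjoint X Y) (hZG : ∀ z ∈ X ∪ Y, z ⊆ G) (hcc : ∀ z ∈ X ∪ Y, G \ z ∈ X ∪ Y) {y : α}
    (hy : y ∈ G) (hG : (G.erase y).Nonempty) (hpos : 0 < #(bothLifts (X ∪ Y) y)) (hlt : #(bothLifts (X ∪ Y) y) < 6)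
    (hdef : 2 * #(bothLifts (monoMeets X Y) y) < #(bothLifts (X ∪ Y) y)) :
    (∃ P Q, S1At X Y G y P Q) ∨
      (((∃ A A' B B', DAt X Y G y A A' B B') ∨ (∃ C C', Q3At X Y G y C C')) ∨ (∃ C C', Q3At Y X G y C C')) := by
  rcases local_structure hy hG hZG hcc hXY hpos hlt hdef with h | h | h | h
  · exact Or.inl h
  · exact Or.inr (Or.inl (Or.inl h))
  · exact Or.inr (Or.inl (Or.inr h))
  · exact Or.inr (Or.inr h)

/-- **THREE DEFICIT POINTS CANNOT COEXIST** (given a fourth point of `G`). [this work] -/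
theorem false_of_three_deficit (hXY : Disjoint X Y) (hZG : ∀ z ∈ X ∪ Y, z ⊆ G) (hcc : ∀ z ∈ X ∪ Y, G \ z ∈ X ∪ Y)
    {y₁ y₂ y₃ : α} (hy₁ : y₁ ∈ G) (hy₂ : y₂ ∈ G) (hy₃ : y₃ ∈ G) (h12 : y₁ ≠ y₂) (h13 : y₁ ≠ y₃) (h23 : y₂ ≠ y₃)
    (hG4 : ∃ t ∈ G, t ≠ y₁ ∧ t ≠ y₂ ∧ t ≠ y₃)
    (hd : ∀ y ∈ ({y₁, y₂, y₃} : Finset α), 0 < #(bothLifts (X ∪ Y) y) ∧ #(bothLifts (X ∪ Y) y) < 6 ∧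
      2 * #(bothLifts (monoMeets X Y) y) < #(bothLifts (X ∪ Y) y)) : False := by
  have ne : ∀ {y y' : α}, y ≠ y' → y' ∈ G → (G.erase y).Nonempty := fun h h' => ⟨_, mem_erase.2 ⟨h.symm, h'⟩⟩
  obtain ⟨hp₁, hl₁, hd₁⟩ := hd y₁ (by simp)
  obtain ⟨hp₂, hl₂, hd₂⟩ := hd y₂ (by simp)
  obtain ⟨hp₃, hl₃, hd₃⟩ := hd y₃ (by simp)
  have c₁ := deficit_cases hXY hZG hcc hy₁ (ne h12 hy₂) hp₁ hl₁ hd₁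
  have c₂ := deficit_cases hXY hZG hcc hy₂ (ne h12.symm hy₁) hp₂ hl₂ hd₂
  have c₃ := deficit_cases hXY hZG hcc hy₃ (ne h13.symm hy₁) hp₃ hl₃ hd₃
  have g12 : ∃ t ∈ G, t ≠ y₁ ∧ t ≠ y₂ := ⟨y₃, hy₃, h13.symm, h23.symm⟩
  have g13 : ∃ t ∈ G, t ≠ y₁ ∧ t ≠ y₃ := ⟨y₂, hy₂, h12.symm, h23⟩
  have g23 : ∃ t ∈ G, t ≠ y₂ ∧ t ≠ y₃ := ⟨y₁, hy₁, h12, h13⟩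
  -- an S₁-point excludes every S₂-point
  have mix : ∀ {y y' : α} {P Q : Finset α}, S1At X Y G y P Q → y ≠ y' → (∃ t ∈ G, t ≠ y ∧ t ≠ y') →
      (((∃ A A' B B', DAt X Y G y' A A' B B') ∨ (∃ C C', Q3At X Y G y' C C')) ∨ (∃ C C', Q3At Y X G y' C C')) →
      False := by
    intro y y' P Q h hyy' hg p
    rcases p with (⟨A, A', B, B', h'⟩ | ⟨C, C', h'⟩) | ⟨C, C', h'⟩
    · exact h.false_of_DAt hXY h' hyy' hg
    · exact h.false_of_Q3At hXY h' hyy' hg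
    · exact h.false_of_Q3At' hXY h' hyy' hg
  rcases c₁ with ⟨P₁, Q₁, s₁⟩ | t₁
  · rcases c₂ with ⟨P₂, Q₂, s₂⟩ | t₂
    · rcases c₃ with ⟨P₃, Q₃, s₃⟩ | t₃
      · exact s₁.false_of_three hXY s₂ s₃ h12 h13 h23
      · exact mix s₁ h13 g13 t₃
    · exact mix s₁ h12 g12 t₂
  rcases c₂ with ⟨P₂, Q₂, s₂⟩ | t₂
  · have g21 : ∃ t ∈ G, t ≠ y₂ ∧ t ≠ y₁ := ⟨y₃, hy₃, h23.symm, h13.symm⟩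
    exact mix s₂ h12.symm g21 t₁
  rcases c₃ with ⟨P₃, Q₃, s₃⟩ | t₃
  · have g31 : ∃ t ∈ G, t ≠ y₃ ∧ t ≠ y₁ := ⟨y₂, hy₂, h23, h12.symm⟩
    exact mix s₃ h13.symm g31 t₁
  -- all three are S₂-points
  have hcc' : ∀ z ∈ Y ∪ X, G \ z ∈ Y ∪ X := by rw [union_comm]; exact hcc
  by_cases h0 : (∅ : Finset α) ∈ X ∪ Y
  · have hG : G ∈ X ∪ Y := by have := hcc _ h0; rwa [sdiff_empty] at this
    -- orient the classes so that `G ∈ K'`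
    have orient : ∀ {K K' : Finset (Finset α)}, Disjoint K K' → (∀ z ∈ K ∪ K', G \ z ∈ K ∪ K') → G ∈ K' →
        (∀ {y : α}, (((∃ A A' B B', DAt K K' G y A A' B B') ∨ (∃ C C', Q3At K K' G y C C')) ∨
          (∃ C C', Q3At K' K G y C C')) → (∃ A A' B B', DAt K K' G y A A' B B') ∨ (∃ C C', Q3At K K' G y C C')) := by
      intro K K' hKK' _ hGK' y p
      rcases p with p | ⟨C, C', h⟩
      · exact p
      · exact absurd hGK' (fun h' => disjoint_left.1 hKK' h.univ_mem h')
    rcases mem_union.1 hG with hGX | hGY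
    · -- `G ∈ X`: work with the classes `(Y, X)`
      have sw : ∀ {y : α}, (((∃ A A' B B', DAt X Y G y A A' B B') ∨ (∃ C C', Q3At X Y G y C C')) ∨
          (∃ C C', Q3At Y X G y C C')) → (((∃ A A' B B', DAt Y X G y A A' B B') ∨ (∃ C C', Q3At Y X G y C C')) ∨
          (∃ C C', Q3At X Y G y C C')) := by
        intro y p
        rcases p with (⟨A, A', B, B', h⟩ | h) | h
        · exact Or.inl (Or.inl ⟨B, B', A, A', h.swap⟩)
        · exact Or.inr h
        · exact Or.inl (Or.inr h)
      exact s2_three_false hXY.symm hcc' hGX h12 h13 h23 hG4 (orient hXY.symm hcc' hGX (sw t₁))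
        (orient hXY.symm hcc' hGX (sw t₂)) (orient hXY.symm hcc' hGX (sw t₃))
    · exact s2_three_false hXY hcc hGY h12 h13 h23 hG4 (orient hXY hcc hGY t₁) (orient hXY hcc hGY t₂)
        (orient hXY hcc hGY t₃)
  · -- `∅ ∉ Z`: every S₂-point is a D-point
    have onlyD : ∀ {y : α}, (((∃ A A' B B', DAt X Y G y A A' B B') ∨ (∃ C C', Q3At X Y G y C C')) ∨
        (∃ C C', Q3At Y X G y C C')) → ∃ A A' B B', DAt X Y G y A A' B B' := by
      intro y p
      rcases p with (p | ⟨C, C', h⟩) | ⟨C, C', h⟩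
      · exact p
      · exfalso; apply h0
        have := hcc _ (mem_union_right _ h.univ_mem); rwa [Finset.sdiff_self] at this
      · exfalso; apply h0
        have := hcc _ (mem_union_left _ h.univ_mem); rwa [Finset.sdiff_self] at this
    obtain ⟨A₁, A₁', B₁, B₁', d₁⟩ := onlyD t₁
    obtain ⟨A₂, A₂', B₂, B₂', d₂⟩ := onlyD t₂
    obtain ⟨A₃, A₃', B₃, B₃', d₃⟩ := onlyD t₃
    exact DAt.false_of_three hXY d₁ d₂ d₃ h12 h13 h23 hG4

end Assembly

/-! ### 2. `SparseTwinPoint` and the rainbow lemma from the small cases alone -/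

/-- **THEOREM (`SparseTwinPoint`).**  Every sparse 2-coloured complement-closed family with at least five antipodal pairs
has a twin point.  (At least ten members force `#G ≥ 4`; if no point were a twin point, any three points of `G` would be
deficit, contradicting `false_of_three_deficit`.) [this work] -/
theorem sparseTwinPoint : SparseTwinPoint α := by
  intro G X Y hZG hcc hXY h10 hsparse
  by_contra H
  push Not at H
  -- four distinct points of `G`
  have hG4 : 4 ≤ #G := by
    by_contra h
    push Not at h
    have := card_le_two_pow_card hZG
    have h3 : 2 ^ #G ≤ 2 ^ 3 := Nat.pow_le_pow_right (by norm_num) (by omega)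
    omega
  obtain ⟨y₁, hy₁⟩ : G.Nonempty := card_pos.1 (by omega)
  obtain ⟨y₂, hy₂⟩ : (G.erase y₁).Nonempty := card_pos.1 (by rw [card_erase_of_mem hy₁]; omega)
  obtain ⟨h21, hy₂G⟩ := mem_erase.1 hy₂
  obtain ⟨y₃, hy₃⟩ : ((G.erase y₁).erase y₂).Nonempty :=
    card_pos.1 (by rw [card_erase_of_mem hy₂, card_erase_of_mem hy₁]; omega)
  obtain ⟨h32, hy₃'⟩ := mem_erase.1 hy₃
  obtain ⟨h31, hy₃G⟩ := mem_erase.1 hy₃'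
  obtain ⟨y₄, hy₄⟩ : (((G.erase y₁).erase y₂).erase y₃).Nonempty :=
    card_pos.1 (by rw [card_erase_of_mem hy₃, card_erase_of_mem hy₂, card_erase_of_mem hy₁]; omega)
  obtain ⟨h43, hy₄'⟩ := mem_erase.1 hy₄
  obtain ⟨h42, hy₄''⟩ := mem_erase.1 hy₄'
  obtain ⟨h41, hy₄G⟩ := mem_erase.1 hy₄''
  refine false_of_three_deficit hXY hZG hcc hy₁ hy₂G hy₃G h21.symm h31.symm h32.symm
    ⟨y₄, hy₄G, h41, h42, h43⟩ ?_
  intro y hy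
  have hyG : y ∈ G := by
    simp only [mem_insert, mem_singleton] at hy
    rcases hy with rfl | rfl | rfl <;> assumption
  exact ⟨(hsparse y hyG).1, (hsparse y hyG).2, H y hyG⟩

/-- **`SmallTwoColourMeets ⟹ TwoColourMeets`**: the two-colouring statement (gen 40's three-family inequality M3♯) now rests
only on its cases with three or four antipodal pairs. [this work] -/
theorem twoColourMeets_of_small (hS : SmallTwoColourMeets α) : TwoColourMeets α :=
  twoColourMeets_of_twinPoint sparseTwinPoint hS

/-- **`SmallTwoColourMeets ⟹ RainbowStrict`.** [this work] -/
theorem rainbowStrict_of_small (hS : SmallTwoColourMeets α) : RainbowStrict α :=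
  rainbowStrict_of_twinPoint sparseTwinPoint hS

/-- **`SmallTwoColourMeets ⟹ RainbowMeetCojoin`**: the rainbow lemma now rests only on the two-colouring statement for
`#Z ∈ {6, 8}` (verified dimension-free by computation, `prim-masterthm-p1/code-g41/c/atoms.c`). [this work] -/
theorem rainbowMeetCojoin_of_small (hS : SmallTwoColourMeets α) : RainbowMeetCojoin α :=
  rainbowMeetCojoin_of_twinPoint sparseTwinPoint hS

end Summit.CriticalPhenomena.PercolationContinuityZ3.Theorems.SahiColouredDaykin
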